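import Summits.QuantumFields.YangMills.Theorems.UnitScaleTiltHalvingHT4TGammaOfLeafSocketsGamma
import Summits.QuantumFields.YangMills.Theorems.UnitScaleTiltHalvingSLetTauFlatCubeMember
import Summits.QuantumFields.YangMills.Theorems.UnitScaleTiltHalvingH59GammaDischargeFlatAllLevels
import Summits.QuantumFields.YangMills.Theorems.UnitScaleTiltHalvingHSockets2OfLeafSocketsHwin
import Summits.QuantumFields.YangMills.Theorems.UnitScaleTiltHalvingHSupURhoWindowMcKc2
import Summits.QuantumFields.YangMills.Theorems.UnitScaleTiltHalvingHSupURhoWindowsGamma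
import Summits.QuantumFields.YangMills.Theorems.UnitScaleTiltHalvingHSupURhoWindowsRho3
import Summits.QuantumFields.YangMills.Theorems.UnitScaleTiltHalvingHGammaComposerJoins
import HarnessLib

/-!
# Line H (`BirthV10.stub_halvingStep`, stmt-QuantumFields-19200) — v9 «hT4TLγ-REDUCE-γ», FILE (β1) (successor LEAD-H ★w5-19200 g7 WORDS 18∕19 «SPLIT»):
# ★★ `hT4TLγ9_holds_member` — THE STEP PACK's THEOREM-4 DATUM ROW `hT4TLγ` IS A THEOREM ON PRINT's p. 98 SUB-LATTICE (floor-parametric, px10 g3's `H59TLγ5_holds_member` shape)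

Cell `ym3-torus` (HUMAN RULING D-0037: YM₃ on T³ is ladder rung R3 — NOT d = 4, NOT infinite volume, NOT a mass gap, NOT the Clay problem), width seat `ym-ust-19200-w7` gen 7.
`--supports stmt-QuantumFields-19200 --as helper`; THEOREMS ONLY (0 `def`, 0 `sorry`); count-neutral; nothing here claims `hSupUρ5`, the stub, the crux or the gap.

WHAT.  Per odd `L > 1` there are the [4]-letter constants `B₀'H B₂' BG BR` (px9 g5 ✓`HalvingSLetTauFlatCubeMember.SLetτAllL_holds_member`, [Balaban1985BackgroundPropagators] Thm 3.1 at
`U₀ = 1` on the sub-lattice — a THEOREM), a floor `Bs ≥ 1` (px10 g3 ✓`HalvingH59GammaDischargeFlatAllLevels.H59D_allLevels_flat_member5`, Theorem 4's flat two-member (1.59) at every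
truncation — a THEOREM) and sub-lattice letters `sx ρ₅` such that for every `M′`, every `B₀ ≥ Bs`, `Bbd ≥ Bs` with `4·Bbd ≤ (3L−1)·B₀`, every `cB9 > 0`, and every ρ5 member of the packs
(✓`HalvingH59GammaDischargeFlatRho5.H59TLγ5_holds_member`'s prefix VERBATIM: `L^(sx+1) ∣ ρ′`, `L^(sx+1) ∣ M′`, `ρ₅ ≤ ρ`, the schedule, the cubic smallness `hw`, room, field, corner,
letters `α₁ α₄ c⋆ s`), the composers' guarded Theorem-4 socket WITH SUPPORT CLAUSE `hT4Tγ` HOLDS — i.e. the STEP pack's displayed row `hT4TLγ` of BOARD v8 (✓p691476 :94–111) is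
DISCHARGED.  Proof = ONE `exact` into px3 g4's ✓`HalvingHT4TGammaOfLeafSocketsGamma.hT4Tγ_of_leafSocketsγ` (p691956; = lit ✓`B8Thm4SupportLocalBdryG.thm4_exists_all_levels_supp_landau138_γ_mem`
over the raw γ-sockets) fed by: the two leaf theorems AT THEIR OWN CONSTANTS (`SLetτAll` := px9's, `H59Dc` := px10's at `(B₀, Bbd)` above the floor); the JOIN's 26-row window block `hwin`
:= ✓`HalvingHSockets2OfLeafSockets.hwin_of_harvestRows` over the ρ-window harvest ✓`HalvingHSupURhoWindowsRho3.exists_topCall_constants_of_rhoWindow₃` (every row named) and the three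
non-harvest rows ✓`HalvingHSupURhoWindowMcKc2.hwin_rows_20_26_27_of_hw` (row 20, (1.103)∕(1.106) at `c_DA = 2dL²c⋆`); the γ-driver∕JOIN windows ✓`HalvingHSupURhoWindowsGamma.gammaWindows_of_hw`∕
`_cstar_of_hw` (`Z := 1 + cB9⁻¹`); the letter identification `α₁ c⋆ α₄ s` = the harvest's `α₁ c⋆ α₄ a₆₆` (`B₀′ = 300·L·m₀·(B₀'H + 15L²·BG·BR + 3·BG·BR·B₂′)`, `d = 3`); the collar
window `hbdry` by ✓`HalvingHGammaComposerJoins.hbdry_of_hBd`.  NO monotonicity lemma: the socket is instantiated at the suppliers' exact constants (LEAD-H WORD 14∕18).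
USE (px20 g4's PACK-STEP (S9) shell, (β2)): `obtain ⟨B₀'H, B₂', BG, BR, Bs4, sx4, ρ4, hB₀'H, hB₂', hBG, hBR, hBs4, HS, H4⟩ := hT4TLγ9_holds_member L hL` once per `L` (the pack's
`B₀'H B₂' BG BR` come FROM HERE; the composer's top-level `SLetτ` slot := `HS F hF n K hnK a M′ ρ′ hdvM′ hdiv hρ₅ (K − n) hk1 le_rfl`), then at the member
`H4 M′ B₀ Bbd cB9 hBsB₀ hBsBbd hBd4 hcB9 F hF n K hnK ρ S M _ rfl hdiv4 hdvM'4 hρ4 hM hS a₅ Cr ε₀ ε₁ hCr hCr4 h12 hε₁ hε₀ hε₀a hCrε hw hroom V hV U hU x₀ 0 le_rfl hM'z _ rfl α₁ α₄ cstar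
hα₁def hcdef hα₄def a₆₆ hsdef` = the composer's `hT4Tγ` argument (exactly where ✓p691476 passed `hT4 …`).
HONEST SCOPE.  By-name composition + scalar bookkeeping; nothing of Prop. 5, Theorem 4, (1.59), [4] Thm 3.1∕3.3 is proved HERE (they are the cited suppliers' theorems); nothing of the
stub, the crux, the rung or the gap.
References: T. Bałaban, CMP **99** (1985) 75–102 [Balaban1985RegularSpaces] (Thm 4 p.88, Prop. 5 (1.106)–(1.109) p.94, (1.102)–(1.103) p.93, (1.58)–(1.59) p.86, (1.29) p.81, p.98);
CMP **99** (1985) 389–434 [Balaban1985BackgroundPropagators] (Thm 3.1 p.397, Thm 3.3 p.399); CMP **98** (1985) 17–51 [Balaban1985Averaging] ((42)–(43) pp.23–24).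
-/

set_option autoImplicit false

noncomputable section

open scoped BigOperators Matrix.Norms.L2Operator
open NormedSpace
open Complex (I)

namespace Summit.QuantumFields.YangMills.Theorems.HalvingHT4TLGammaHoldsMember

open Literature.MathematicalPhysics.QuantumFieldTheory.Balaban1983to89
open Literature.MathematicalPhysics.QuantumFieldTheory.Balaban1983to89.T3ContinuumYM3Torus
open Literature.MathematicalPhysics.QuantumFieldTheory.Balaban1983to89.T3PrintedRegularMinimiser (RegPr regFibrePr)
open MatrixLog (mlog)
open B5Eq118OneStroke (iterBlockOf)
open B7Prop1Explicit (e expUnit l1)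
open B7Prop1Explicit renaming Site → LSite
open B7Prop2Explicit (unitaryUnits C0 c2' avgIter)
open B7Prop2SpecialUnitary (specialUnitaryUnits)
open B7Prop3Flat (c3)
open B7Prop1Local (InBox loK bondHiK)
open B7Eq92Concrete (mgauge)
open B8Ineq130 (tlo thi)
open B8Ineq132 (covDerivFwd InAk BondTouches)
open B8Eq119TwistedAxial (Restr129 InAx)
open B8Eq131Cubes (cube tLo tHi)
open B8Eq131CubesAdmissible (cubeFam)
open B8CubeMemberZd (cubeLamS)
open B8Eq184Proof (gaugeExp cfgExp)
open B8Eq140Level (SideTouches)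
open B8Eq138LandauZd (IsLandau138W covLap QT)
open B7Prop4GeneralLevels (linCovIter)
open B8Eq155JBound (Jcur wsup)
open B8ScaledSupNorm (bondNorm msup)
open B8Eq146AExpansion (iEta)
open B8Eq1117Concrete (XSpace)
open B8Prop5ContractionKLevel (Bd2)
open B8LambdaSpaceKLevel (wt)
open B7Eq78Linearization (conjR zdBlocking QprimeIter)
open B8Eq119TwistedAxial (bgT)
open B8SpecialUnitaryTrace (trCLM)
open B10Eq27TorusAxialLog (pull unitsField toUField)
open B9SupplySockB9P3ZdBeta (CrossB) open B9SupplySockB9P3ZdGamma (cubeLamBP')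
open HalvingHT4TGammaOfLeafSocketsGamma (hT4Tγ_of_leafSocketsγ)
open HalvingSLetTauFlatCubeMember (SLetτAllL_holds_member)
open HalvingH59GammaDischargeFlatAllLevels (H59D_allLevels_flat_member5)
open HalvingHSupURhoWindowMcKc2 (hwin_rows_20_26_27_of_hw)
open HalvingHSupURhoWindowsGamma (gammaWindows_of_hw gammaWindows_cstar_of_hw)
open HalvingHSupURhoWindowsRho3 (exists_topCall_constants_of_rhoWindow₃)

set_option maxHeartbeats 400000 in
/-- ★★ **THE STEP PACK's THEOREM-4 DATUM ROW `hT4TLγ` FROM px9's «LETTERS AT EVERY TRUNCATION» ROW AT GIVEN CONSTANTS** (floor-parametric in `B₀ Bbd`, any `cB9 > 0`;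
see the module docstring). [cite: Balaban1985RegularSpaces, Thm 4 p.88, Prop. 5 (1.106)-(1.109) p.94, (1.58)-(1.59) p.86, (1.29) p.81, p.98; Balaban1985BackgroundPropagators, Thm 3.1 p.397, Thm 3.3 p.399] -/
theorem hT4TLγ9_of_sLetτAll (L : ℕ) (hL : 1 < L) {B₀'H B₂' BG BR : ℝ} (hB₀'H : 0 < B₀'H) (hB₂' : 0 ≤ B₂') (hBG : 0 ≤ BG) (hBR : 0 ≤ BR) {sxS ρS : ℕ}
    -- px9 g5's LEAF THEOREM ROW «[4] letters at every truncation on the sub-lattice» (✓`SLetτAllL_holds_member`'s body VERBATIM at `(sx, ρ₅) := (sxS, ρS)`)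
    (HS : ∀ (F : T3Family), F.L = L → ∀ (n K : ℕ), n < K → ∀ (a : LSite (F.P K).d) (M' ρ' : ℕ),
      L ^ (sxS + 1) ∣ M' → L ^ (sxS + 1) ∣ ρ' → ρS ≤ ρ' → ∀ (n' : ℕ), 1 ≤ n' → n' ≤ K - n →
      ∃ (g Δ : (LSite (F.P K).d → Matrix (Fin 2) (Fin 2) ℂ) →ₗ[ℂ] (LSite (F.P K).d → Matrix (Fin 2) (Fin 2) ℂ))
      (q : (LSite (F.P K).d → Matrix (Fin 2) (Fin 2) ℂ) →ₗ[ℂ] (ℕ → LSite (F.P K).d → Matrix (Fin 2) (Fin 2) ℂ))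
      (qs : (ℕ → LSite (F.P K).d → Matrix (Fin 2) (Fin 2) ℂ) →ₗ[ℂ] (LSite (F.P K).d → Matrix (Fin 2) (Fin 2) ℂ))
      (Aw c : (ℕ → LSite (F.P K).d → Matrix (Fin 2) (Fin 2) ℂ) →ₗ[ℂ] (ℕ → LSite (F.P K).d → Matrix (Fin 2) (Fin 2) ℂ))
      (H' : XSpace (F.P K).d n' (Matrix (Fin 2) (Fin 2) ℂ) →ₗ[ℂ] (LSite (F.P K).d → Matrix (Fin 2) (Fin 2) ℂ)),
      (∀ x, ∀ y ∈ cubeFam false (F.P K).L a M' ρ' (K - n) 0, (Δ (g x) + qs (Aw (q (g x)))) y = x y) ∧ (∀ f, q (g (g (qs (c (q f))))) = q f) ∧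
      (∀ (f : LSite (F.P K).d → Matrix (Fin 2) (Fin 2) ℂ), ∀ x ∈ cubeFam false (F.P K).L a M' ρ' (K - n) 0,
      Δ f x = covLap (((F.L : ℝ)⁻¹) ^ (K - n)) (1 : LSite (F.P K).d → Fin (F.P K).d → (Matrix (Fin 2) (Fin 2) ℂ)ˣ) ((cubeFam false (F.P K).L a M' ρ' (K - n) 0).indicator f) x) ∧
      (∀ (μ : ℕ → LSite (F.P K).d → Matrix (Fin 2) (Fin 2) ℂ), ∀ x ∈ cubeFam false (F.P K).L a M' ρ' (K - n) 0,
      qs μ x = QT (F.P K).L n' (cubeLamS (F.P K).L a M' ρ' (K - n) n') (1 : LSite (F.P K).d → Fin (F.P K).d → (Matrix (Fin 2) (Fin 2) ℂ)ˣ) μ x) ∧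
      (∀ (f : LSite (F.P K).d → Matrix (Fin 2) (Fin 2) ℂ) (j : ℕ), j ≤ n' → ∀ y ∈ cubeLamS (F.P K).L a M' ρ' (K - n) n' j,
      q f j y = QprimeIter (zdBlocking (F.P K).d (F.P K).L) (bgT (F.P K).L (1 : LSite (F.P K).d → Fin (F.P K).d → (Matrix (Fin 2) (Fin 2) ℂ)ˣ)) j f y) ∧
      (∀ (X : XSpace (F.P K).d n' (Matrix (Fin 2) (Fin 2) ℂ)) (x : LSite (F.P K).d), ‖H' X x‖ ≤ B₀'H * ‖X‖) ∧
      (∀ j, j ≤ n' → ∀ (X : XSpace (F.P K).d n' (Matrix (Fin 2) (Fin 2) ℂ)), ∀ p ∈ {b : LSite (F.P K).d × Fin (F.P K).d | SideTouches (cubeFam false (F.P K).L a M' ρ' (K - n) j) b.1 b.2},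
      wt (F.P K).L (((F.L : ℝ)⁻¹) ^ (K - n)) j * ‖covDerivFwd (((F.L : ℝ)⁻¹) ^ (K - n)) (1 : LSite (F.P K).d → Fin (F.P K).d → (Matrix (Fin 2) (Fin 2) ℂ)ˣ) p.2 (H' X) p.1‖ ≤ B₀'H * ‖X‖) ∧
      (∀ X : XSpace (F.P K).d n' (Matrix (Fin 2) (Fin 2) ℂ), Bd2 (F.P K).L (((F.L : ℝ)⁻¹) ^ (K - n)) n' (cubeFam false (F.P K).L a M' ρ' (K - n))
      (covLap (((F.L : ℝ)⁻¹) ^ (K - n)) (1 : LSite (F.P K).d → Fin (F.P K).d → (Matrix (Fin 2) (Fin 2) ℂ)ˣ) (H' X)) (B₂' * ‖X‖)) ∧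
      (∀ (X : XSpace (F.P K).d n' (Matrix (Fin 2) (Fin 2) ℂ)) (x : LSite (F.P K).d), x ∉ cubeFam false (F.P K).L a M' ρ' (K - n) 0 → H' X x = 0) ∧
      (∀ X Y : XSpace (F.P K).d n' (Matrix (Fin 2) (Fin 2) ℂ), (∀ p, Y p = -star (X p)) → ∀ x, H' Y x = -star (H' X x)) ∧
      (∀ (Y : XSpace (F.P K).d n' (Matrix (Fin 2) (Fin 2) ℂ)) (j : ℕ) (hj : j ≤ n') (y : LSite (F.P K).d), y ∈ cubeLamS (F.P K).L a M' ρ' (K - n) n' j →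
      QprimeIter (zdBlocking (F.P K).d (F.P K).L) (bgT (F.P K).L (1 : LSite (F.P K).d → Fin (F.P K).d → (Matrix (Fin 2) (Fin 2) ℂ)ˣ)) j (H' Y) y = Y (⟨j, Nat.lt_succ_of_le hj⟩, y)) ∧
      (∀ (f : LSite (F.P K).d → Matrix (Fin 2) (Fin 2) ℂ) (r : ℝ), 0 ≤ r → Bd2 (F.P K).L (((F.L : ℝ)⁻¹) ^ (K - n)) n' (cubeFam false (F.P K).L a M' ρ' (K - n)) f r →
      (∀ x, ‖g f x‖ ≤ BG * r) ∧ ∀ j, j ≤ n' → ∀ p ∈ {b : LSite (F.P K).d × Fin (F.P K).d | SideTouches (cubeFam false (F.P K).L a M' ρ' (K - n) j) b.1 b.2},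
      wt (F.P K).L (((F.L : ℝ)⁻¹) ^ (K - n)) j * ‖covDerivFwd (((F.L : ℝ)⁻¹) ^ (K - n)) (1 : LSite (F.P K).d → Fin (F.P K).d → (Matrix (Fin 2) (Fin 2) ℂ)ˣ) p.2 (g f) p.1‖ ≤ BG * r) ∧
      (∀ (f : LSite (F.P K).d → Matrix (Fin 2) (Fin 2) ℂ) (x : LSite (F.P K).d), x ∉ cubeFam false (F.P K).L a M' ρ' (K - n) 0 → g f x = 0) ∧
      (∀ f : LSite (F.P K).d → Matrix (Fin 2) (Fin 2) ℂ, (∀ j, j ≤ n' → ∀ x ∈ cubeFam false (F.P K).L a M' ρ' (K - n) j, IsSelfAdjoint (f x)) → ∀ x, IsSelfAdjoint (g f x)) ∧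
      (∀ (f : LSite (F.P K).d → Matrix (Fin 2) (Fin 2) ℂ) (r : ℝ), 0 ≤ r → Bd2 (F.P K).L (((F.L : ℝ)⁻¹) ^ (K - n)) n' (cubeFam false (F.P K).L a M' ρ' (K - n)) f r →
      Bd2 (F.P K).L (((F.L : ℝ)⁻¹) ^ (K - n)) n' (cubeFam false (F.P K).L a M' ρ' (K - n)) (f - g (qs (c (q (g f))))) (BR * r)) ∧
      (∀ f : LSite (F.P K).d → Matrix (Fin 2) (Fin 2) ℂ, (∀ j, j ≤ n' → ∀ x ∈ cubeFam false (F.P K).L a M' ρ' (K - n) j, IsSelfAdjoint (f x)) →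
      ∀ j, j ≤ n' → ∀ x ∈ cubeFam false (F.P K).L a M' ρ' (K - n) j, IsSelfAdjoint ((f - g (qs (c (q (g f))))) x)) ∧
      (∀ X : XSpace (F.P K).d n' (Matrix (Fin 2) (Fin 2) ℂ), (∀ p, trCLM (Fin 2) (X p) = 0) → ∀ x, trCLM (Fin 2) (H' X x) = 0) ∧
      (∀ f : LSite (F.P K).d → Matrix (Fin 2) (Fin 2) ℂ, (∀ j, j ≤ n' → ∀ x ∈ cubeFam false (F.P K).L a M' ρ' (K - n) j, trCLM (Fin 2) (f x) = 0) → ∀ x, trCLM (Fin 2) (g f x) = 0) ∧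
      (∀ f : LSite (F.P K).d → Matrix (Fin 2) (Fin 2) ℂ, (∀ j, j ≤ n' → ∀ x ∈ cubeFam false (F.P K).L a M' ρ' (K - n) j, trCLM (Fin 2) (f x) = 0) →
      ∀ j, j ≤ n' → ∀ x ∈ cubeFam false (F.P K).L a M' ρ' (K - n) j, trCLM (Fin 2) ((f - g (qs (c (q (g f))))) x) = 0)) :
    ∃ (Bs : ℝ) (sx ρ₅ : ℕ), 1 ≤ Bs ∧
    ∀ (M' : ℕ) (B₀ Bbd cB9 : ℝ), Bs ≤ B₀ → Bs ≤ Bbd → 4 * Bbd ≤ (3 * (L : ℝ) - 1) * B₀ → 0 < cB9 →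
    -- the ρ5 member prefix of the packs (✓`H59TLγ5_holds_member`'s letters VERBATIM: sub-lattice guards, schedule, smallness `hw`, room, the field, the member's corner and letters)
    ∀ (F : T3Family), F.L = L → ∀ (n K : ℕ) (hnK : n < K) (ρ S M ρ' : ℕ), ρ' = ρ + M + L + S →
      L ^ (sx + 1) ∣ ρ + M + L + S → L ^ (sx + 1) ∣ M' → ρ₅ ≤ ρ →
      1 ≤ M → 2 ≤ S → ∀ (a₅ Cr ε₀ ε₁ : ℝ), 0 < Cr → 4 < Cr → 12 * ((ρ : ℝ) + (M : ℝ)) * a₅ ≤ Cr → 0 < ε₁ → 0 < ε₀ → ε₀ ≤ a₅ → Cr * ε₁ ≤ ε₀ →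
      (10 : ℝ) ^ 29 * (L : ℝ) ^ 12 * (1 + B₀ + B₀⁻¹) ^ 2 * ((1 + B₀'H) * (1 + B₂') * (1 + BG) * (1 + BR)) ^ 5 * (1 + cB9⁻¹) * ((((ρ + M + L + S : ℕ) : ℝ) + (M' : ℝ) + 1) ^ 3 * ε₀) ≤ 1 →
      2 * ρ + (M' + 1 + 2 * (M + L + S)) ≤ F.L ^ (F.m + n) → ∀ (V : GaugeField (F.P n) 0 (Matrix.specialUnitaryGroup (Fin 2) ℂ)), PlaqSmall ε₁ V → ∀ U ∈ regFibrePr F n K hnK.le ε₀ V,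
      ∀ (x₀ : Site (F.P K) 0) (t : ℤ), 0 ≤ t → t ≤ (M' : ℤ) - 1 → ∀ (a : LSite (F.P K).d), a = (fun μ => ((iterBlockOf (K - n) x₀ μ).val : ℤ) - t) →
      ∀ (α₁ α₄ cstar : ℝ), α₁ = 198 * (((ρ' : ℝ) + M' + 1) * ε₀) + 27 * (((ρ' : ℝ) + M' + 1) * ε₀) / ((L : ℝ) * B₀) → cstar = 5 * (F.P K).d * (F.P K).L * B₀ * (ε₀ + α₁) →
      α₄ = 8 * (300 * (L : ℝ) * ((3 * (M' + ρ') + 1 : ℕ) : ℝ) * (B₀'H + 15 * (L : ℝ) ^ 2 * BG * BR + 3 * BG * BR * B₂')) * (5 * ((3 : ℕ) : ℝ) * L * B₀) * (ε₀ + α₁) → ∀ (s : ℝ), s = (198 + 12 * (((M' : ℝ) - 1) + 4 * ρ')) * ε₀ →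
    -- CONCLUSION = the composers' guarded Theorem-4 socket `hT4Tγ` (✓`hT4Tγ_of_leafSocketsγ`'s conclusion VERBATIM)
      ∀ gJ : GaugeTransf (F.P K) 0 (Matrix.specialUnitaryGroup (Fin 2) ℂ),
        InAk (F.P K).L (K - n) (((F.L : ℝ)⁻¹) ^ (K - n)) ε₀ (fun _ => (Set.univ : Set (LSite (F.P K).d))) (pull (unitsField (toUField (GaugeField.gaugeAct gJ U))) 0) →
        (∀ m', m' ≤ K - n → ∀ Λ : ℕ → Set (LSite (F.P K).d),
          InAx (F.P K).L m' Λ (1 : LSite (F.P K).d → Fin (F.P K).d → (Matrix (Fin 2) (Fin 2) ℂ)ˣ) (pull (unitsField (toUField (GaugeField.gaugeAct gJ U))) 0)) →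
        (∀ m', m' ≤ K - n → ∀ (x : LSite (F.P K).d) (ν : Fin (F.P K).d), tlo (F.P K).L (tLo a ρ') m' ≤ x → x + e ν ≤ thi (F.P K).L (tHi a M' ρ') m' →
          ‖((avgIter (F.P K).L (pull (unitsField (toUField (GaugeField.gaugeAct gJ U))) 0) (K - n - m') x ν : (Matrix (Fin 2) (Fin 2) ℂ)ˣ) :
              Matrix (Fin 2) (Fin 2) ℂ) - 1‖ < s) →
        (∀ (x : LSite (F.P K).d) (ν : Fin (F.P K).d), tlo (F.P K).L (tLo a ρ') (K - n) ≤ x → x + e ν ≤ thi (F.P K).L (tHi a M' ρ') (K - n) →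
          ‖((pull (unitsField (toUField (GaugeField.gaugeAct gJ U))) 0 x ν : (Matrix (Fin 2) (Fin 2) ℂ)ˣ) : Matrix (Fin 2) (Fin 2) ℂ) - 1‖ < s) →
        ∀ m, m ≤ K - n → ∃ u : LSite (F.P K).d → (Matrix (Fin 2) (Fin 2) ℂ)ˣ,
          (∀ x, ((u x : (Matrix (Fin 2) (Fin 2) ℂ)ˣ) : Matrix (Fin 2) (Fin 2) ℂ) ∈ Matrix.specialUnitaryGroup (Fin 2) ℂ) ∧
          (∀ x, x ∉ cubeFam false (F.P K).L a M' ρ' (K - n) 0 → u x = 1) ∧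
          Restr129 (F.P K).L m (cubeLamS (F.P K).L a M' ρ' (K - n) m) (1 : LSite (F.P K).d → Fin (F.P K).d → (Matrix (Fin 2) (Fin 2) ℂ)ˣ) u ∧
          ∃ W : LSite (F.P K).d → Fin (F.P K).d → (Matrix (Fin 2) (Fin 2) ℂ)ˣ,
            mgauge (1 : LSite (F.P K).d → Fin (F.P K).d → (Matrix (Fin 2) (Fin 2) ℂ)ˣ) u W = pull (unitsField (toUField (GaugeField.gaugeAct gJ U))) 0 ∧
            (1 ≤ m → IsLandau138W (F.P K).L m (((F.L : ℝ)⁻¹) ^ (K - n)) (cubeFam false (F.P K).L a M' ρ' (K - n) 0) (cubeLamS (F.P K).L a M' ρ' (K - n) m)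
              (1 : LSite (F.P K).d → Fin (F.P K).d → (Matrix (Fin 2) (Fin 2) ℂ)ˣ) W) ∧
            ∃ A : LSite (F.P K).d → Fin (F.P K).d → Matrix (Fin 2) (Fin 2) ℂ, ∀ j, j ≤ m →
              ∀ b ∈ {b : LSite (F.P K).d × Fin (F.P K).d | SideTouches (cubeFam false (F.P K).L a M' ρ' (K - n) j) b.1 b.2},
                W b.1 b.2 = cfgExp (((F.L : ℝ)⁻¹) ^ (K - n)) A b.1 b.2 ∧ IsSelfAdjoint (A b.1 b.2) ∧
                  ‖A b.1 b.2‖ ≤ cstar * (((F.P K).L : ℝ) ^ j * ((F.L : ℝ)⁻¹) ^ (K - n))⁻¹ := by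
  classical
  -- px10 g3's LEAF THEOREM: Theorem 4's flat two-member (1.59) at every level on the sub-lattice (the floor `Bs`)
  obtain ⟨BsA, sxA, ρA, hBsA1, HA⟩ := H59D_allLevels_flat_member5 L hL
  refine ⟨BsA, max sxS sxA, max ρS ρA, hBsA1, ?_⟩
  intro M' B₀ Bbd cB9 hBsB₀ hBsBbd hBd4 hcB9 F hF n K hnK ρ S M ρ' hρ'def hdiv hdvM' hρ₅ hM _ a₅ Cr ε₀ ε₁ _ _ _ _ hε₀ _ _ hw _ V _ U _ x₀ t _ _ a hadef
    α₁ α₄ cstar hα₁def hcdef hα₄def s hsdef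
  subst hρ'def
  have hB₀ : 0 < B₀ := lt_of_lt_of_le (lt_of_lt_of_le zero_lt_one hBsA1) hBsB₀
  have hBbd : (0 : ℝ) ≤ Bbd := (zero_le_one.trans hBsA1).trans hBsBbd
  have hpw : ∀ {u v : ℕ}, u ≤ v → L ^ (u + 1) ∣ L ^ (v + 1) := fun h => pow_dvd_pow L (Nat.succ_le_succ h)
  have hdvS : L ^ (sxS + 1) ∣ M' := (hpw (le_max_left _ _)).trans hdvM'
  have hdvA : L ^ (sxA + 1) ∣ M' := (hpw (le_max_right _ _)).trans hdvM'
  have hdivS : L ^ (sxS + 1) ∣ ρ + M + L + S := (hpw (le_max_left _ _)).trans hdiv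
  have hdivA : L ^ (sxA + 1) ∣ ρ + M + L + S := (hpw (le_max_right _ _)).trans hdiv
  have hρρ' : ρ ≤ ρ + M + L + S := by omega
  have hρS : ρS ≤ ρ + M + L + S := ((le_max_left _ _).trans hρ₅).trans hρρ'
  have hρA : ρA ≤ ρ + M + L + S := ((le_max_right _ _).trans hρ₅).trans hρρ'
  have hρL : L ≤ ρ + M + L + S := by omega
  have hk1 : 1 ≤ K - n := by omega
  have hs0 : 0 ≤ s := by
    have h1 : (1 : ℝ) ≤ ((ρ + M + L + S : ℕ) : ℝ) := by exact_mod_cast (show 1 ≤ ρ + M + L + S by omega)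
    have h2 : (0 : ℝ) ≤ (M' : ℝ) := Nat.cast_nonneg _
    have h3 : (0 : ℝ) ≤ 198 + 12 * (((M' : ℝ) - 1) + 4 * ((ρ + M + L + S : ℕ) : ℝ)) := by linarith only [h1, h2]
    rw [hsdef]; exact mul_nonneg h3 hε₀.le
  have hd3 : (F.P K).d = 3 := T3Family.P_d F K
  have hLF : (F.P K).L = F.L := rfl
  have hL2P : 2 ≤ (F.P K).L := by rw [hLF, hF]; omega
  have hLr : ((F.P K).L : ℝ) = (L : ℝ) := by rw [hLF, hF]
  have hw' := hw; rw [← hLr] at hw'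
  -- the ρ-window HARVEST at `(M′, ρ′)` — every row named (groups (0)–(3), (5) at `τ := 0`)
  obtain ⟨m₀, α₀, α₁h, a₆₆, csh, B₀', α₄h, C₂, cB, cA, cDA, c', σ, δ, ω, Cb, Cl, τ₀, e0, eα₀, ea, e1, ec, eB, e4, eC, ecB, ecA, ecDA, ecp, eσ, hδ, hω, hτ₀,
    ⟨-, -, hα₁, -, hsα₁, -, hB₀', -, -, -, -, -, -, -, -, -, -, -, hτ₀pos⟩,
    ⟨hs84, hs₂, ha4, h2s, hα3, hα4, h16, hd5, -, -, hside, h50, hC₂p, -⟩,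
    ⟨hε9, hcs9, h36, h2cs, hsmall₁, -, -, -, hexpcB, hc3cB, h2048, h40d, h200C6, h12000, hC4G, h1024, h32, h16d, h8d, h2C6, hcA13, hCbfl, -, -, -, -, -⟩,
    -, hwin5⟩ :=
    exists_topCall_constants_of_rhoWindow₃ (F.P K).d (F.P K).L hd3 hL2P hB₀ hB₀'H hB₂' hBG hBR hcB9 M' (ρ + M + L + S) hε₀ hw'
  obtain ⟨-, h5a, h5b, h5c, -, -, -⟩ := hwin5 0 le_rfl hτ₀pos.le
  -- the three non-harvest rows (20, 26, 27) at `cDA := 2dL²c⋆` (✓`hwin_rows_20_26_27_of_hw`) and the JOIN's 26-row `hwin` block (✓`hwin_of_harvestRows`)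
  have hW3 := hwin_rows_20_26_27_of_hw (F.P K).d (F.P K).L hd3 hL2P hB₀ hB₀'H hB₂' hBG hBR hcB9 M' (ρ + M + L + S) hε₀ hw' e0 eα₀ e1 ec eB e4
  subst eα₀
  have hwin9 := HalvingHSockets2OfLeafSockets.hwin_of_harvestRows (F.P K).d (F.P K).L hB₀'H ec e4 eC ecB ecA hα3 hα4 hC₂p hε9 hcs9 h36 h2cs hsmall₁ hexpcB hc3cB
    h2048 h40d h200C6 h12000 hC4G h1024 h32 h16d h8d h2C6 hcA13 hCbfl h5a h5b h5c hBR hW3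
  -- EDITION γ windows from the same `hw` (✓`gammaWindows_of_hw`, `Z := 1 + cB9⁻¹`)
  have hC9 : (1 : ℝ) ≤ 1 + cB9⁻¹ := by have := (inv_pos.2 hcB9).le; linarith only [this]
  obtain ⟨hα3γ, hα4γ, h16Pγ, hsmallPγ, hc₃Pγ, hC₂γ, h61γ, h61γ₀⟩ :=
    gammaWindows_of_hw (F.P K).d (F.P K).L hd3 hL2P M' (ρ + M + L + S) hε₀ hB₀ hB₀'H hB₂' hBG hBR hC9 e0 e1 ec eB e4 hw'
  obtain ⟨h16γ, hsmallγ, hc₃γ⟩ := gammaWindows_cstar_of_hw (F.P K).d (F.P K).L hd3 hL2P M' (ρ + M + L + S) hε₀ hB₀ hB₀'H hB₂' hBG hBR hC9 e0 e1 ec eB e4 hw'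
  -- identify the harvest's letters with the member prefix's `α₁ cstar α₄ s`
  have eα₁ : α₁h = α₁ := by rw [e1, hα₁def, hLr]
  subst eα₁
  have ecs : csh = cstar := by rw [ec, hcdef]
  subst ecs
  have eα₄ : α₄h = α₄ := by rw [e4, eB, e0, hα₄def, hd3, hLr]
  subst eα₄
  have ea66 : a₆₆ = s := by rw [ea, hsdef]; ring
  subst ea66
  have hdL1 : 1 ≤ (F.P K).d * (F.P K).L := le_trans (by omega : 1 ≤ (F.P K).L) (Nat.le_mul_of_pos_left _ (by omega))
  have hBd' : 4 * Bbd ≤ (((F.P K).d : ℝ) * (F.P K).L - 1) * B₀ := by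
    have h3L : (((F.P K).d : ℝ)) * ((F.P K).L : ℝ) = 3 * (L : ℝ) := by rw [hd3, hLr]; norm_num
    rw [h3L]; exact hBd4
  have hbdry := HalvingHGammaComposerJoins.hbdry_of_hBd hdL1 hB₀.le hs0 hsα₁ hε₀.le hBd'
  -- ONE `exact` into px3 g4's γ driver wrapper over the leaf sockets (px9 g5, p691956)
  exact hT4Tγ_of_leafSocketsγ F L hF hk1 ρ S M M' rfl hε₀ hs0 U x₀ hadef hα₁ hB₀ hB₀' e4 hsα₁ hsmall₁ ec hs84 hs₂ ha4 h2s hα3γ hα4γ h16Pγ h16 hd5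
    hsmallPγ hc₃Pγ hside h50 hBbd hbdry hC₂γ h61γ h16γ hsmallγ hc₃γ h61γ₀ hBd' hB₀'H hB₂' hBG hBR (HS F hF n K hnK a M' (ρ + M + L + S) hdvS hdivS hρS) hwin9
    (fun c hc0 hc => HA F hF n K hnK a M' (ρ + M + L + S) hρL hdivA hdvA hρA B₀ Bbd c hBsB₀ hBsBbd hc0 hc)


set_option maxHeartbeats 400000 in
/-- ★★ **THE SAME, WITH px9's LETTER CONSTANTS OPENED ONCE**: per odd `L > 1` the [4]-letter constants `B₀'H B₂' BG BR` (= ✓`SLetτAllL_holds_member`'s witnesses), a floor `Bs ≥ 1`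
and sub-lattice letters `sx ρ₅` carrying BOTH (i) the «letters at every truncation» row (the composer's top-level `SLetτ` slot is its `n′ := K − n` instance — px9 g5, kernel-checked)
AND (ii) the `hT4TLγ` row — so the STEP pack reads every [4]∕Theorem-4 constant from ONE `obtain`. [cite: Balaban1985RegularSpaces, Thm 4 p.88, Prop. 5 p.94; Balaban1985BackgroundPropagators, Thm 3.1 p.397, Thm 3.3 p.399] -/
theorem hT4TLγ9_holds_member (L : ℕ) (hL : 1 < L) :
    ∃ (B₀'H B₂' BG BR Bs : ℝ) (sx ρ₅ : ℕ), 0 < B₀'H ∧ 0 ≤ B₂' ∧ 0 ≤ BG ∧ 0 ≤ BR ∧ 1 ≤ Bs ∧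
    -- (i) px9 g5's «[4] letters at every truncation» row at THESE constants (for the composer's top-level `SLetτ` slot: instantiate at `n′ := K − n`)
    (∀ (F : T3Family), F.L = L → ∀ (n K : ℕ), n < K → ∀ (a : LSite (F.P K).d) (M' ρ' : ℕ),
      L ^ (sx + 1) ∣ M' → L ^ (sx + 1) ∣ ρ' → ρ₅ ≤ ρ' → ∀ (n' : ℕ), 1 ≤ n' → n' ≤ K - n →
      ∃ (g Δ : (LSite (F.P K).d → Matrix (Fin 2) (Fin 2) ℂ) →ₗ[ℂ] (LSite (F.P K).d → Matrix (Fin 2) (Fin 2) ℂ))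
      (q : (LSite (F.P K).d → Matrix (Fin 2) (Fin 2) ℂ) →ₗ[ℂ] (ℕ → LSite (F.P K).d → Matrix (Fin 2) (Fin 2) ℂ))
      (qs : (ℕ → LSite (F.P K).d → Matrix (Fin 2) (Fin 2) ℂ) →ₗ[ℂ] (LSite (F.P K).d → Matrix (Fin 2) (Fin 2) ℂ))
      (Aw c : (ℕ → LSite (F.P K).d → Matrix (Fin 2) (Fin 2) ℂ) →ₗ[ℂ] (ℕ → LSite (F.P K).d → Matrix (Fin 2) (Fin 2) ℂ))
      (H' : XSpace (F.P K).d n' (Matrix (Fin 2) (Fin 2) ℂ) →ₗ[ℂ] (LSite (F.P K).d → Matrix (Fin 2) (Fin 2) ℂ)),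
      (∀ x, ∀ y ∈ cubeFam false (F.P K).L a M' ρ' (K - n) 0, (Δ (g x) + qs (Aw (q (g x)))) y = x y) ∧ (∀ f, q (g (g (qs (c (q f))))) = q f) ∧
      (∀ (f : LSite (F.P K).d → Matrix (Fin 2) (Fin 2) ℂ), ∀ x ∈ cubeFam false (F.P K).L a M' ρ' (K - n) 0,
      Δ f x = covLap (((F.L : ℝ)⁻¹) ^ (K - n)) (1 : LSite (F.P K).d → Fin (F.P K).d → (Matrix (Fin 2) (Fin 2) ℂ)ˣ) ((cubeFam false (F.P K).L a M' ρ' (K - n) 0).indicator f) x) ∧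
      (∀ (μ : ℕ → LSite (F.P K).d → Matrix (Fin 2) (Fin 2) ℂ), ∀ x ∈ cubeFam false (F.P K).L a M' ρ' (K - n) 0,
      qs μ x = QT (F.P K).L n' (cubeLamS (F.P K).L a M' ρ' (K - n) n') (1 : LSite (F.P K).d → Fin (F.P K).d → (Matrix (Fin 2) (Fin 2) ℂ)ˣ) μ x) ∧
      (∀ (f : LSite (F.P K).d → Matrix (Fin 2) (Fin 2) ℂ) (j : ℕ), j ≤ n' → ∀ y ∈ cubeLamS (F.P K).L a M' ρ' (K - n) n' j,
      q f j y = QprimeIter (zdBlocking (F.P K).d (F.P K).L) (bgT (F.P K).L (1 : LSite (F.P K).d → Fin (F.P K).d → (Matrix (Fin 2) (Fin 2) ℂ)ˣ)) j f y) ∧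
      (∀ (X : XSpace (F.P K).d n' (Matrix (Fin 2) (Fin 2) ℂ)) (x : LSite (F.P K).d), ‖H' X x‖ ≤ B₀'H * ‖X‖) ∧
      (∀ j, j ≤ n' → ∀ (X : XSpace (F.P K).d n' (Matrix (Fin 2) (Fin 2) ℂ)), ∀ p ∈ {b : LSite (F.P K).d × Fin (F.P K).d | SideTouches (cubeFam false (F.P K).L a M' ρ' (K - n) j) b.1 b.2},
      wt (F.P K).L (((F.L : ℝ)⁻¹) ^ (K - n)) j * ‖covDerivFwd (((F.L : ℝ)⁻¹) ^ (K - n)) (1 : LSite (F.P K).d → Fin (F.P K).d → (Matrix (Fin 2) (Fin 2) ℂ)ˣ) p.2 (H' X) p.1‖ ≤ B₀'H * ‖X‖) ∧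
      (∀ X : XSpace (F.P K).d n' (Matrix (Fin 2) (Fin 2) ℂ), Bd2 (F.P K).L (((F.L : ℝ)⁻¹) ^ (K - n)) n' (cubeFam false (F.P K).L a M' ρ' (K - n))
      (covLap (((F.L : ℝ)⁻¹) ^ (K - n)) (1 : LSite (F.P K).d → Fin (F.P K).d → (Matrix (Fin 2) (Fin 2) ℂ)ˣ) (H' X)) (B₂' * ‖X‖)) ∧
      (∀ (X : XSpace (F.P K).d n' (Matrix (Fin 2) (Fin 2) ℂ)) (x : LSite (F.P K).d), x ∉ cubeFam false (F.P K).L a M' ρ' (K - n) 0 → H' X x = 0) ∧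
      (∀ X Y : XSpace (F.P K).d n' (Matrix (Fin 2) (Fin 2) ℂ), (∀ p, Y p = -star (X p)) → ∀ x, H' Y x = -star (H' X x)) ∧
      (∀ (Y : XSpace (F.P K).d n' (Matrix (Fin 2) (Fin 2) ℂ)) (j : ℕ) (hj : j ≤ n') (y : LSite (F.P K).d), y ∈ cubeLamS (F.P K).L a M' ρ' (K - n) n' j →
      QprimeIter (zdBlocking (F.P K).d (F.P K).L) (bgT (F.P K).L (1 : LSite (F.P K).d → Fin (F.P K).d → (Matrix (Fin 2) (Fin 2) ℂ)ˣ)) j (H' Y) y = Y (⟨j, Nat.lt_succ_of_le hj⟩, y)) ∧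
      (∀ (f : LSite (F.P K).d → Matrix (Fin 2) (Fin 2) ℂ) (r : ℝ), 0 ≤ r → Bd2 (F.P K).L (((F.L : ℝ)⁻¹) ^ (K - n)) n' (cubeFam false (F.P K).L a M' ρ' (K - n)) f r →
      (∀ x, ‖g f x‖ ≤ BG * r) ∧ ∀ j, j ≤ n' → ∀ p ∈ {b : LSite (F.P K).d × Fin (F.P K).d | SideTouches (cubeFam false (F.P K).L a M' ρ' (K - n) j) b.1 b.2},
      wt (F.P K).L (((F.L : ℝ)⁻¹) ^ (K - n)) j * ‖covDerivFwd (((F.L : ℝ)⁻¹) ^ (K - n)) (1 : LSite (F.P K).d → Fin (F.P K).d → (Matrix (Fin 2) (Fin 2) ℂ)ˣ) p.2 (g f) p.1‖ ≤ BG * r) ∧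
      (∀ (f : LSite (F.P K).d → Matrix (Fin 2) (Fin 2) ℂ) (x : LSite (F.P K).d), x ∉ cubeFam false (F.P K).L a M' ρ' (K - n) 0 → g f x = 0) ∧
      (∀ f : LSite (F.P K).d → Matrix (Fin 2) (Fin 2) ℂ, (∀ j, j ≤ n' → ∀ x ∈ cubeFam false (F.P K).L a M' ρ' (K - n) j, IsSelfAdjoint (f x)) → ∀ x, IsSelfAdjoint (g f x)) ∧
      (∀ (f : LSite (F.P K).d → Matrix (Fin 2) (Fin 2) ℂ) (r : ℝ), 0 ≤ r → Bd2 (F.P K).L (((F.L : ℝ)⁻¹) ^ (K - n)) n' (cubeFam false (F.P K).L a M' ρ' (K - n)) f r →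
      Bd2 (F.P K).L (((F.L : ℝ)⁻¹) ^ (K - n)) n' (cubeFam false (F.P K).L a M' ρ' (K - n)) (f - g (qs (c (q (g f))))) (BR * r)) ∧
      (∀ f : LSite (F.P K).d → Matrix (Fin 2) (Fin 2) ℂ, (∀ j, j ≤ n' → ∀ x ∈ cubeFam false (F.P K).L a M' ρ' (K - n) j, IsSelfAdjoint (f x)) →
      ∀ j, j ≤ n' → ∀ x ∈ cubeFam false (F.P K).L a M' ρ' (K - n) j, IsSelfAdjoint ((f - g (qs (c (q (g f))))) x)) ∧
      (∀ X : XSpace (F.P K).d n' (Matrix (Fin 2) (Fin 2) ℂ), (∀ p, trCLM (Fin 2) (X p) = 0) → ∀ x, trCLM (Fin 2) (H' X x) = 0) ∧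
      (∀ f : LSite (F.P K).d → Matrix (Fin 2) (Fin 2) ℂ, (∀ j, j ≤ n' → ∀ x ∈ cubeFam false (F.P K).L a M' ρ' (K - n) j, trCLM (Fin 2) (f x) = 0) → ∀ x, trCLM (Fin 2) (g f x) = 0) ∧
      (∀ f : LSite (F.P K).d → Matrix (Fin 2) (Fin 2) ℂ, (∀ j, j ≤ n' → ∀ x ∈ cubeFam false (F.P K).L a M' ρ' (K - n) j, trCLM (Fin 2) (f x) = 0) →
      ∀ j, j ≤ n' → ∀ x ∈ cubeFam false (F.P K).L a M' ρ' (K - n) j, trCLM (Fin 2) ((f - g (qs (c (q (g f))))) x) = 0)) ∧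
    -- (ii) the STEP pack's displayed `hT4TLγ` row at the same constants, floor-parametric in `B₀ Bbd`, any `cB9 > 0`
    (∀ (M' : ℕ) (B₀ Bbd cB9 : ℝ), Bs ≤ B₀ → Bs ≤ Bbd → 4 * Bbd ≤ (3 * (L : ℝ) - 1) * B₀ → 0 < cB9 →
    -- the ρ5 member prefix of the packs (✓`H59TLγ5_holds_member`'s letters VERBATIM: sub-lattice guards, schedule, smallness `hw`, room, the field, the member's corner and letters)
    ∀ (F : T3Family), F.L = L → ∀ (n K : ℕ) (hnK : n < K) (ρ S M ρ' : ℕ), ρ' = ρ + M + L + S →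
      L ^ (sx + 1) ∣ ρ + M + L + S → L ^ (sx + 1) ∣ M' → ρ₅ ≤ ρ →
      1 ≤ M → 2 ≤ S → ∀ (a₅ Cr ε₀ ε₁ : ℝ), 0 < Cr → 4 < Cr → 12 * ((ρ : ℝ) + (M : ℝ)) * a₅ ≤ Cr → 0 < ε₁ → 0 < ε₀ → ε₀ ≤ a₅ → Cr * ε₁ ≤ ε₀ →
      (10 : ℝ) ^ 29 * (L : ℝ) ^ 12 * (1 + B₀ + B₀⁻¹) ^ 2 * ((1 + B₀'H) * (1 + B₂') * (1 + BG) * (1 + BR)) ^ 5 * (1 + cB9⁻¹) * ((((ρ + M + L + S : ℕ) : ℝ) + (M' : ℝ) + 1) ^ 3 * ε₀) ≤ 1 →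
      2 * ρ + (M' + 1 + 2 * (M + L + S)) ≤ F.L ^ (F.m + n) → ∀ (V : GaugeField (F.P n) 0 (Matrix.specialUnitaryGroup (Fin 2) ℂ)), PlaqSmall ε₁ V → ∀ U ∈ regFibrePr F n K hnK.le ε₀ V,
      ∀ (x₀ : Site (F.P K) 0) (t : ℤ), 0 ≤ t → t ≤ (M' : ℤ) - 1 → ∀ (a : LSite (F.P K).d), a = (fun μ => ((iterBlockOf (K - n) x₀ μ).val : ℤ) - t) →
      ∀ (α₁ α₄ cstar : ℝ), α₁ = 198 * (((ρ' : ℝ) + M' + 1) * ε₀) + 27 * (((ρ' : ℝ) + M' + 1) * ε₀) / ((L : ℝ) * B₀) → cstar = 5 * (F.P K).d * (F.P K).L * B₀ * (ε₀ + α₁) →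
      α₄ = 8 * (300 * (L : ℝ) * ((3 * (M' + ρ') + 1 : ℕ) : ℝ) * (B₀'H + 15 * (L : ℝ) ^ 2 * BG * BR + 3 * BG * BR * B₂')) * (5 * ((3 : ℕ) : ℝ) * L * B₀) * (ε₀ + α₁) → ∀ (s : ℝ), s = (198 + 12 * (((M' : ℝ) - 1) + 4 * ρ')) * ε₀ →
    -- CONCLUSION = the composers' guarded Theorem-4 socket `hT4Tγ` (✓`hT4Tγ_of_leafSocketsγ`'s conclusion VERBATIM)
      ∀ gJ : GaugeTransf (F.P K) 0 (Matrix.specialUnitaryGroup (Fin 2) ℂ),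
        InAk (F.P K).L (K - n) (((F.L : ℝ)⁻¹) ^ (K - n)) ε₀ (fun _ => (Set.univ : Set (LSite (F.P K).d))) (pull (unitsField (toUField (GaugeField.gaugeAct gJ U))) 0) →
        (∀ m', m' ≤ K - n → ∀ Λ : ℕ → Set (LSite (F.P K).d),
          InAx (F.P K).L m' Λ (1 : LSite (F.P K).d → Fin (F.P K).d → (Matrix (Fin 2) (Fin 2) ℂ)ˣ) (pull (unitsField (toUField (GaugeField.gaugeAct gJ U))) 0)) →
        (∀ m', m' ≤ K - n → ∀ (x : LSite (F.P K).d) (ν : Fin (F.P K).d), tlo (F.P K).L (tLo a ρ') m' ≤ x → x + e ν ≤ thi (F.P K).L (tHi a M' ρ') m' →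
          ‖((avgIter (F.P K).L (pull (unitsField (toUField (GaugeField.gaugeAct gJ U))) 0) (K - n - m') x ν : (Matrix (Fin 2) (Fin 2) ℂ)ˣ) :
              Matrix (Fin 2) (Fin 2) ℂ) - 1‖ < s) →
        (∀ (x : LSite (F.P K).d) (ν : Fin (F.P K).d), tlo (F.P K).L (tLo a ρ') (K - n) ≤ x → x + e ν ≤ thi (F.P K).L (tHi a M' ρ') (K - n) →
          ‖((pull (unitsField (toUField (GaugeField.gaugeAct gJ U))) 0 x ν : (Matrix (Fin 2) (Fin 2) ℂ)ˣ) : Matrix (Fin 2) (Fin 2) ℂ) - 1‖ < s) →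
        ∀ m, m ≤ K - n → ∃ u : LSite (F.P K).d → (Matrix (Fin 2) (Fin 2) ℂ)ˣ,
          (∀ x, ((u x : (Matrix (Fin 2) (Fin 2) ℂ)ˣ) : Matrix (Fin 2) (Fin 2) ℂ) ∈ Matrix.specialUnitaryGroup (Fin 2) ℂ) ∧
          (∀ x, x ∉ cubeFam false (F.P K).L a M' ρ' (K - n) 0 → u x = 1) ∧
          Restr129 (F.P K).L m (cubeLamS (F.P K).L a M' ρ' (K - n) m) (1 : LSite (F.P K).d → Fin (F.P K).d → (Matrix (Fin 2) (Fin 2) ℂ)ˣ) u ∧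
          ∃ W : LSite (F.P K).d → Fin (F.P K).d → (Matrix (Fin 2) (Fin 2) ℂ)ˣ,
            mgauge (1 : LSite (F.P K).d → Fin (F.P K).d → (Matrix (Fin 2) (Fin 2) ℂ)ˣ) u W = pull (unitsField (toUField (GaugeField.gaugeAct gJ U))) 0 ∧
            (1 ≤ m → IsLandau138W (F.P K).L m (((F.L : ℝ)⁻¹) ^ (K - n)) (cubeFam false (F.P K).L a M' ρ' (K - n) 0) (cubeLamS (F.P K).L a M' ρ' (K - n) m)
              (1 : LSite (F.P K).d → Fin (F.P K).d → (Matrix (Fin 2) (Fin 2) ℂ)ˣ) W) ∧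
            ∃ A : LSite (F.P K).d → Fin (F.P K).d → Matrix (Fin 2) (Fin 2) ℂ, ∀ j, j ≤ m →
              ∀ b ∈ {b : LSite (F.P K).d × Fin (F.P K).d | SideTouches (cubeFam false (F.P K).L a M' ρ' (K - n) j) b.1 b.2},
                W b.1 b.2 = cfgExp (((F.L : ℝ)⁻¹) ^ (K - n)) A b.1 b.2 ∧ IsSelfAdjoint (A b.1 b.2) ∧
                  ‖A b.1 b.2‖ ≤ cstar * (((F.P K).L : ℝ) ^ j * ((F.L : ℝ)⁻¹) ^ (K - n))⁻¹) := by
  obtain ⟨B₀'H, B₂', BG, BR, sxS, ρS, hB₀'H, hB₂', hBG, hBR, HS⟩ := SLetτAllL_holds_member L hL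
  obtain ⟨Bs, sx4, ρ4, hBs1, H4⟩ := hT4TLγ9_of_sLetτAll L hL hB₀'H hB₂' hBG hBR HS
  have hpw : ∀ {u v : ℕ}, u ≤ v → L ^ (u + 1) ∣ L ^ (v + 1) := fun h => pow_dvd_pow L (Nat.succ_le_succ h)
  refine ⟨B₀'H, B₂', BG, BR, Bs, max sxS sx4, max ρS ρ4, hB₀'H, hB₂', hBG, hBR, hBs1, ?_, ?_⟩
  · intro F hF n K hnK a M' ρ' hdM hdρ hρ₅
    exact HS F hF n K hnK a M' ρ' ((hpw (le_max_left _ _)).trans hdM) ((hpw (le_max_left _ _)).trans hdρ) ((le_max_left _ _).trans hρ₅)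
  · intro M' B₀ Bbd cB9 hBsB₀ hBsBbd hBd4 hcB9 F hF n K hnK ρ S M ρ' hρ'def hdiv hdvM' hρ₅
    exact H4 M' B₀ Bbd cB9 hBsB₀ hBsBbd hBd4 hcB9 F hF n K hnK ρ S M ρ' hρ'def ((hpw (le_max_right _ _)).trans hdiv) ((hpw (le_max_right _ _)).trans hdvM')
      ((le_max_right _ _).trans hρ₅)

end Summit.QuantumFields.YangMills.Theorems.HalvingHT4TLGammaHoldsMember

end
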